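import Summits.QuantumFields.YangMills.Theorems.UnitScaleTiltAxialGaugeCombWalk
import HarnessLib

/-!
# `UnitScaleTiltAxialGaugeBondModulus` — THE TRANSLATION MODULUS OF AN AXIAL-GAUGE BOND VARIABLE ON `ℤ^d` IN TERMS OF THE SIZE AND THE
# TRANSLATION MODULUS OF THE GAUGED PLAQUETTE VARIABLES (file 2∕2 of R1′; route `UnitScaleTilt`, crux K1′ `MinimiserStabilityRegPr`
# stmt-QuantumFields-19200, (L3′b)-GRAD row (★) «η-scale ½-Hölder modulus of the axial-gauge representative»; ★★OWNER RULING №35-B,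
# ★p1 g25 CHAIR WORD №4 «R1 + the torus transfer → px19»)

Cell `ym3-torus` (YM ladder rung R3 = continuum SU(2) Yang–Mills on T³ — a RUNG, NOT the Clay problem: not d = 4, not infinite volume, not a mass gap);
width seat `ym3-torus-px19` (gen 12); helper `--supports stmt-QuantumFields-19200`.  THEOREMS ONLY (0 `def`, 0 `sorry`, default heartbeats), any
`[GaugeGroup G]`, on the `ℤ^d` carrier of lit ✓`B7Prop1Explicit` ∕ ✓`B8Lemma1NonAbelian`; over file 1∕2 ✓`UnitScaleTiltAxialGaugeCombWalk` (rung
recursion `axial_bond_step`, `seg_rungs`, `seg_plaquettes`, `comb_walk`).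

THE THEOREM (★★★`dist1_axial_bond_translate_le`).  `W := V^{v₀}` the complete axial gauge of `V` based at `0`, `μ` a direction, `x` and `x + s` in
the box `{|z_κ| ≤ R}`, `|s_κ| ≤ S`; every plaquette `V(∂p_{κμ}(z))` (`κ < μ`, `z` in the box) within `a` of `1`; the GAUGED plaquettes with
translation discrepancies `dist1 (W(∂p_{κμ}(z + t))·W(∂p_{κμ}(z))⁻¹) ≤ p` for `z` in the box, `κ < μ`, every coordinate restriction `t` of `s`.  Then
  `dist1 (W(x + s, μ)·W(x, μ)⁻¹) ≤ d·S·a + d²·R·p`.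
Claim A (`dist1_translate_high`): a translation vanishing below `μ` moves the whole low comb rigidly, rails stay tree bonds ⟹ `≤ μ·R·p`
(`comb_walk` at level `μ`, reset bonds trivial).  Claim B (`dist1_translate_low`): the low coordinates one at a time — `s_κ e_κ` (`κ < μ`) costs
`comb_walk` down to level `κ` (`κ·R·p`) plus a segment of `|s_κ|` plaquettes (`|s_κ|·a`, `seg_plaquettes`).  Telescoping over the coordinates.
With the member's letters (`a = ε₀η²`, `R ∼ η⁻¹`, `S = |s|_∞ ≤ η⁻¹`) and R3′'s K-uniform curvature ½-Hölder modulus in the axial gauge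
(`p ≲ ε₀η²(|s|η)^{½}`, w5 g14 FILE B in pair form) this is the (★) row `≲ ε₀η·(|s|η)^{½}` (`|s|·ε₀η² ≤ ε₀η(|s|η)^{½}` for `|s| ≤ η⁻¹`); the torus
transfer (member row with BOTH `RegPr` clauses visible, no-wrap antecedent) is the next file.

HONEST SCOPE.  Lattice gauge bookkeeping and `dist1` algebra; nothing of (★)'s analytic input (R3′), GRAD, `hT`, `hGF`, EX, `MinimiserStabilityRegPr`
(19200) or the rung `YM3TorusSU2` is proved; no summit statement is proved; the Yang–Mills mass gap is NOT proved.
References: [Balaban1985Averaging] (8)–(9) pp. 18–19, pp. 24–25 (axial gauge), (44)–(45) p. 24, (46) p. 25; [Balaban1985RegularSpaces] (1.7)–(1.9) p. 77.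
-/

set_option autoImplicit false

open Literature.MathematicalPhysics.QuantumFieldTheory.Balaban1983to89
open Literature.MathematicalPhysics.QuantumFieldTheory.Balaban1983to89.B7Prop1Explicit (Site e e_apply hol plaqWord gaugeAct axialFn)
open Literature.MathematicalPhysics.QuantumFieldTheory.Balaban1983to89.B8Lemma1NonAbelian (lowPart lowPart_apply lowPart_add zsmul_e_apply)
open Summit.QuantumFields.YangMills.Theorems.AxialGaugeCombWalk

namespace Summit.QuantumFields.YangMills.Theorems.AxialGaugeBondModulus

variable {d : ℕ} {G : Type*} [GaugeGroup G]

/-! ## §5 The translation modulus of an axial-gauge bond variable -/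

/-- ★★ **CLAIM A — TRANSLATIONS VANISHING BELOW `μ`**: for `x` in the box and a coordinate restriction `t` of `s` with `t_κ = 0` for `κ < μ`,
`dist1 (W(x + t, μ)·W(x, μ)⁻¹) ≤ μ·R·p` (walk the whole comb below `μ`; the reset bonds are tree bonds). [cite: Balaban1985Averaging, pp.24-25] -/
theorem dist1_translate_high (V : Site d → Fin d → G) (μ : Fin d) {R : ℕ} {p : ℝ} (hp : 0 ≤ p) (s : Site d)
    (hmod : ∀ z t : Site d, (∀ κ, |z κ| ≤ (R : ℤ)) → (∀ κ, t κ = s κ ∨ t κ = 0) →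
      ∀ κ : Fin d, κ < μ → dist1 (hol (gaugeAct (axialFn V 0) V) (z + t) (plaqWord κ μ) *
        (hol (gaugeAct (axialFn V 0) V) z (plaqWord κ μ))⁻¹) ≤ p)
    (x t : Site d) (hx : ∀ κ, |x κ| ≤ (R : ℤ)) (hts : ∀ κ, t κ = s κ ∨ t κ = 0) (htμ : ∀ κ : Fin d, κ.val < μ.val → t κ = 0) :
    dist1 (gaugeAct (axialFn V 0) V (x + t) μ * (gaugeAct (axialFn V 0) V x μ)⁻¹) ≤ μ.val * R * p := by
  have h := comb_walk V μ hp s hmod μ.val le_rfl x t hx hts htμ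
  have hr : lowPart μ (fun κ : Fin d => if κ.val < μ.val then (0 : ℤ) else x κ) = 0 := lowPart_reset μ.val μ.isLt x
  have htlow : lowPart μ t = 0 := by
    rw [lowPart_eq_zero_iff]; intro κ hκ; exact htμ κ (Fin.lt_def.mp hκ)
  have hr' : lowPart μ ((fun κ : Fin d => if κ.val < μ.val then (0 : ℤ) else x κ) + t) = 0 := by
    rw [lowPart_add, hr, htlow, add_zero]
  rw [axial_bond_eq_one V _ μ hr', axial_bond_eq_one V _ μ hr, inv_one, mul_one, GaugeGroup.dist1_one, zero_add] at h
  exact h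

/-- A partially translated point `x + (s below k)` of the box stays in the box when `x + s` does. [folklore] -/
theorem abs_add_low_le {R : ℕ} {x s : Site d} (hx : ∀ κ, |x κ| ≤ (R : ℤ)) (hxs : ∀ κ, |(x + s) κ| ≤ (R : ℤ)) (k : ℕ)
    (κ : Fin d) : |(x + fun κ' : Fin d => if κ'.val < k then s κ' else 0) κ| ≤ (R : ℤ) := by
  simp only [Pi.add_apply]
  split_ifs
  · exact hxs κ
  · rw [add_zero]; exact hx κ

/-- ★★ **CLAIM B — THE LOW COORDINATES ONE AT A TIME**: for `x`, `x + s` in the box, `|s_κ| ≤ S`, plaquettes of `V` in the box within `a` of `1`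
and `p` as in `comb_walk`, the translation by the part of `s` below `k ≤ μ` costs `dist1 (W(x + s_{<k}, μ)·W(x, μ)⁻¹) ≤ k·(S·a + μ·R·p)`
(each coordinate: `comb_walk` down to its level, then a segment of `|s_κ|` plaquettes). [cite: Balaban1985Averaging, pp.24-25] -/
theorem dist1_translate_low (V : Site d → Fin d → G) (μ : Fin d) {R S : ℕ} {a p : ℝ} (ha : 0 ≤ a) (hp : 0 ≤ p) (s : Site d)
    (hS : ∀ κ, |s κ| ≤ (S : ℤ))
    (hplaq : ∀ z : Site d, (∀ κ, |z κ| ≤ (R : ℤ)) → ∀ κ : Fin d, κ < μ → dist1 (hol V z (plaqWord κ μ)) ≤ a)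
    (hmod : ∀ z t : Site d, (∀ κ, |z κ| ≤ (R : ℤ)) → (∀ κ, t κ = s κ ∨ t κ = 0) →
      ∀ κ : Fin d, κ < μ → dist1 (hol (gaugeAct (axialFn V 0) V) (z + t) (plaqWord κ μ) *
        (hol (gaugeAct (axialFn V 0) V) z (plaqWord κ μ))⁻¹) ≤ p) :
    ∀ k : ℕ, k ≤ μ.val → ∀ x : Site d, (∀ κ, |x κ| ≤ (R : ℤ)) → (∀ κ, |(x + s) κ| ≤ (R : ℤ)) →
      dist1 (gaugeAct (axialFn V 0) V (x + fun κ : Fin d => if κ.val < k then s κ else 0) μ *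
        (gaugeAct (axialFn V 0) V x μ)⁻¹) ≤ k * (S * a + μ.val * R * p)
  | 0, _, x, _, _ => by
    have : (fun κ : Fin d => if κ.val < 0 then s κ else 0) = 0 := by funext κ; simp
    rw [this, add_zero, mul_inv_cancel, GaugeGroup.dist1_one]; simp
  | k + 1, hk, x, hx, hxs => by
    have hkd : k < d := by have := μ.isLt; omega
    have hνμ : (⟨k, hkd⟩ : Fin d) < μ := by rw [Fin.lt_def]; exact hk
    have ih := dist1_translate_low V μ ha hp s hS hplaq hmod k (by omega) x hx hxs
    -- `s_{<k+1} = s_{<k} + s_k e_k`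
    have eL : (fun κ : Fin d => if κ.val < k + 1 then s κ else 0) =
        (fun κ : Fin d => if κ.val < k then s κ else 0) + s ⟨k, hkd⟩ • e (⟨k, hkd⟩ : Fin d) := by
      funext κ
      simp only [Pi.add_apply, zsmul_e_apply]
      by_cases h1 : κ.val < k
      · have h2 : κ ≠ ⟨k, hkd⟩ := fun h => by subst h; simp at h1
        simp [h1, show κ.val < k + 1 by omega, h2]
      · by_cases h2 : κ.val = k
        · have h3 : κ = ⟨k, hkd⟩ := Fin.ext h2
          subst h3
          simp
        · have h3 : κ ≠ ⟨k, hkd⟩ := fun h => h2 (by rw [h])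
          simp [h1, show ¬ κ.val < k + 1 by omega, h3]
    -- the partially translated point `x' = x + s_{<k}` is in the box
    have hx' : ∀ κ, |(x + fun κ' : Fin d => if κ'.val < k then s κ' else 0) κ| ≤ (R : ℤ) := abs_add_low_le hx hxs k
    -- the one-coordinate translation `t = s_k e_k` is a coordinate restriction of `s` vanishing below `k`
    have hsub : ∀ κ : Fin d, (s ⟨k, hkd⟩ • e (⟨k, hkd⟩ : Fin d)) κ = s κ ∨ (s ⟨k, hkd⟩ • e (⟨k, hkd⟩ : Fin d)) κ = 0 := by
      intro κ; rw [zsmul_e_apply]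
      by_cases h : κ = ⟨k, hkd⟩
      · subst h; left; rw [if_pos rfl]
      · right; rw [if_neg h]
    have htk : ∀ κ : Fin d, κ.val < k → (s ⟨k, hkd⟩ • e (⟨k, hkd⟩ : Fin d)) κ = 0 := by
      intro κ hκ; rw [zsmul_e_apply, if_neg]; intro h; subst h; simp at hκ
    have hm := comb_walk V μ hp s hmod k (by omega) _ _ hx' hsub htk
    have hzlow := lowPart_reset k hkd (x + fun κ' : Fin d => if κ'.val < k then s κ' else 0)
    set x' : Site d := x + fun κ' : Fin d => if κ'.val < k then s κ' else 0 with hx'def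
    set z : Site d := fun κ : Fin d => if κ.val < k then (0 : ℤ) else x' κ with hzdef
    -- box membership of the plaquette segment `z + j e_k`, `j` between `0` and `s_k`
    have hzk : z ⟨k, hkd⟩ = x ⟨k, hkd⟩ := by simp [hzdef, hx'def]
    have hxk := abs_le.mp (hx ⟨k, hkd⟩)
    have hxsk := abs_le.mp (hxs ⟨k, hkd⟩)
    simp only [Pi.add_apply] at hxsk
    have hbox : ∀ j : ℤ, |x ⟨k, hkd⟩ + j| ≤ (R : ℤ) → ∀ κ : Fin d, |(z + j • e (⟨k, hkd⟩ : Fin d)) κ| ≤ (R : ℤ) := by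
      intro j hj κ
      simp only [Pi.add_apply, zsmul_e_apply]
      by_cases h1 : κ = ⟨k, hkd⟩
      · subst h1; rw [if_pos rfl, hzk]; exact hj
      · rw [if_neg h1, add_zero]; exact abs_reset_le hx' k κ
    -- the plaquette segment: `dist1 (W(z + s_k e_k, μ)·W(z, μ)⁻¹) ≤ |s_k|·a ≤ S·a`
    have hsegB : dist1 (gaugeAct (axialFn V 0) V (z + s ⟨k, hkd⟩ • e (⟨k, hkd⟩ : Fin d)) μ *
        (gaugeAct (axialFn V 0) V z μ)⁻¹) ≤ S * a := by
      have hSk := hS ⟨k, hkd⟩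
      rcases Int.eq_nat_or_neg (s ⟨k, hkd⟩) with ⟨m, hm' | hm'⟩
      · have hmS : (m : ℝ) ≤ S := by
          have : (m : ℤ) ≤ S := by rw [← hm']; exact (le_abs_self _).trans hSk
          exact_mod_cast this
        have h := seg_plaquettes V hνμ z hzlow (a := a) m (fun i hi => by
          rw [dist1_hol_plaqWord_gaugeAct]
          exact hplaq _ (hbox (i : ℤ) (by rw [abs_le]; rw [hm'] at hxsk; constructor <;> omega)) _ hνμ)
        rw [hm']
        exact h.trans (mul_le_mul_of_nonneg_right hmS ha)
      · have hmS : (m : ℝ) ≤ S := by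
          have : (m : ℤ) ≤ S := by rw [hm', abs_neg] at hSk; exact (le_abs_self _).trans hSk
          exact_mod_cast this
        -- from the lower endpoint `z' = z − m e_k`
        have hz'low : lowPart (⟨k, hkd⟩ : Fin d) (z + (-(m : ℤ)) • e (⟨k, hkd⟩ : Fin d)) = 0 := lowPart_add_zsmul_e hzlow _
        have h := seg_plaquettes V hνμ _ hz'low (a := a) m (fun i hi => by
          rw [dist1_hol_plaqWord_gaugeAct, show z + (-(m : ℤ)) • e (⟨k, hkd⟩ : Fin d) + (i : ℤ) • e ⟨k, hkd⟩ =
            z + (-(m : ℤ) + i) • e (⟨k, hkd⟩ : Fin d) by rw [add_smul]; abel]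
          exact hplaq _ (hbox (-(m : ℤ) + i) (by rw [abs_le]; rw [hm'] at hxsk; constructor <;> omega)) _ hνμ)
        rw [show z + (-(m : ℤ)) • e (⟨k, hkd⟩ : Fin d) + (m : ℤ) • e ⟨k, hkd⟩ = z by rw [add_assoc, ← add_smul]; simp] at h
        rw [hm', ← GaugeGroup.dist1_inv, mul_inv_rev, inv_inv]
        exact h.trans (mul_le_mul_of_nonneg_right hmS ha)
    -- assemble: telescoping `W(x' + t)W(x)⁻¹ = [W(x' + t)W(x')⁻¹]·[W(x')W(x)⁻¹]`
    rw [eL, ← add_assoc]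
    have tele : gaugeAct (axialFn V 0) V (x' + s ⟨k, hkd⟩ • e (⟨k, hkd⟩ : Fin d)) μ * (gaugeAct (axialFn V 0) V x μ)⁻¹ =
        (gaugeAct (axialFn V 0) V (x' + s ⟨k, hkd⟩ • e (⟨k, hkd⟩ : Fin d)) μ * (gaugeAct (axialFn V 0) V x' μ)⁻¹) *
          (gaugeAct (axialFn V 0) V x' μ * (gaugeAct (axialFn V 0) V x μ)⁻¹) := by group
    rw [tele]
    refine (GaugeGroup.dist1_mul_le _ _).trans ?_
    have hkμ : (k : ℝ) * R * p ≤ μ.val * R * p := by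
      have : (k : ℝ) ≤ μ.val := by exact_mod_cast (show k ≤ μ.val by omega)
      exact mul_le_mul_of_nonneg_right (mul_le_mul_of_nonneg_right this (Nat.cast_nonneg R)) hp
    push_cast
    linarith [hm, hsegB, ih]

/-- ★★★ **THE TRANSLATION MODULUS OF AN AXIAL-GAUGE BOND VARIABLE.**  Let `W = V^{v₀}` be the complete axial gauge of `V` based at `0`
(comb order `d−1, …, 0`), `μ` a direction, `x` and `x + s` in the box `{|z_κ| ≤ R}` with `|s_κ| ≤ S`.  If every plaquette `V(∂p_{κμ}(z))`,
`κ < μ`, `z` in the box, is within `a` of `1`, and the GAUGED plaquettes have translation discrepancies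
`dist1 (W(∂p_{κμ}(z + t))·W(∂p_{κμ}(z))⁻¹) ≤ p` for `z` in the box, `κ < μ` and every coordinate restriction `t` of `s`, then
  `dist1 (W(x + s, μ)·W(x, μ)⁻¹) ≤ d·S·a + d²·R·p`.
(With `a = ε₀η²`, `R ∼ η⁻¹`, `S = |s| ≤ η⁻¹` and R3′'s K-uniform curvature modulus `p ≲ ε₀η²(|s|η)^{½}` this is the (★) row `≲ ε₀η(|s|η)^{½}`.)
[cite: Balaban1985Averaging, pp.24-25, (46) p.25] -/
theorem dist1_axial_bond_translate_le (V : Site d → Fin d → G) (μ : Fin d) {R S : ℕ} {a p : ℝ} (ha : 0 ≤ a) (hp : 0 ≤ p)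
    (x s : Site d) (hx : ∀ κ, |x κ| ≤ (R : ℤ)) (hxs : ∀ κ, |(x + s) κ| ≤ (R : ℤ)) (hS : ∀ κ, |s κ| ≤ (S : ℤ))
    (hplaq : ∀ z : Site d, (∀ κ, |z κ| ≤ (R : ℤ)) → ∀ κ : Fin d, κ < μ → dist1 (hol V z (plaqWord κ μ)) ≤ a)
    (hmod : ∀ z t : Site d, (∀ κ, |z κ| ≤ (R : ℤ)) → (∀ κ, t κ = s κ ∨ t κ = 0) →
      ∀ κ : Fin d, κ < μ → dist1 (hol (gaugeAct (axialFn V 0) V) (z + t) (plaqWord κ μ) *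
        (hol (gaugeAct (axialFn V 0) V) z (plaqWord κ μ))⁻¹) ≤ p) :
    dist1 (gaugeAct (axialFn V 0) V (x + s) μ * (gaugeAct (axialFn V 0) V x μ)⁻¹) ≤
      (d : ℝ) * S * a + (d : ℝ) ^ 2 * R * p := by
  -- `s = s_{<μ} + s_{≥μ}`
  have es : s = (fun κ : Fin d => if κ.val < μ.val then s κ else 0) + (fun κ : Fin d => if κ.val < μ.val then (0 : ℤ) else s κ) := by
    funext κ; simp only [Pi.add_apply]; split_ifs <;> simp
  have hlow := dist1_translate_low V μ ha hp s hS hplaq hmod μ.val le_rfl x hx hxs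
  have hx' : ∀ κ, |(x + fun κ' : Fin d => if κ'.val < μ.val then s κ' else 0) κ| ≤ (R : ℤ) := abs_add_low_le hx hxs μ.val
  have hsub : ∀ κ : Fin d, (fun κ' : Fin d => if κ'.val < μ.val then (0 : ℤ) else s κ') κ = s κ ∨
      (fun κ' : Fin d => if κ'.val < μ.val then (0 : ℤ) else s κ') κ = 0 := by
    intro κ; simp only; split_ifs
    · right; rfl
    · left; rfl
  have htμ : ∀ κ : Fin d, κ.val < μ.val → (fun κ' : Fin d => if κ'.val < μ.val then (0 : ℤ) else s κ') κ = 0 := by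
    intro κ hκ; simp [hκ]
  have hhigh := dist1_translate_high V μ hp s hmod _ _ hx' hsub htμ
  set x' : Site d := x + fun κ' : Fin d => if κ'.val < μ.val then s κ' else 0 with hx'def
  set t : Site d := fun κ' : Fin d => if κ'.val < μ.val then (0 : ℤ) else s κ' with htdef
  have exs : x + s = x' + t := by rw [es, ← add_assoc]
  rw [exs]
  have tele : gaugeAct (axialFn V 0) V (x' + t) μ * (gaugeAct (axialFn V 0) V x μ)⁻¹ =
      (gaugeAct (axialFn V 0) V (x' + t) μ * (gaugeAct (axialFn V 0) V x' μ)⁻¹) *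
        (gaugeAct (axialFn V 0) V x' μ * (gaugeAct (axialFn V 0) V x μ)⁻¹) := by group
  rw [tele]
  refine (GaugeGroup.dist1_mul_le _ _).trans ?_
  have hμd : (μ.val : ℝ) + 1 ≤ d := by exact_mod_cast μ.isLt
  have hμ0 : (0 : ℝ) ≤ μ.val := Nat.cast_nonneg _
  have hSa : 0 ≤ (S : ℝ) * a := by positivity
  have hRp : 0 ≤ (R : ℝ) * p := by positivity
  nlinarith [hhigh, hlow, mul_le_mul_of_nonneg_right hμd hSa, mul_le_mul_of_nonneg_right hμd hRp,
    mul_le_mul_of_nonneg_right hμd (mul_nonneg hμ0 hRp)]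

end Summit.QuantumFields.YangMills.Theorems.AxialGaugeBondModulus
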